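import Literature.Probability.RandomPlanarGeometry.Curve
import Literature.Probability.RandomPlanarGeometry.CurveSpace
import Literature.Probability.RandomPlanarGeometry.SLE
import Literature.Probability.RandomPlanarGeometry.PlanarDomains
import Literature.Probability.LatticeModels.LatticeGraph
import Literature.Probability.Percolation.Percolation
import Literature.Probability.LatticeModels.DomainDiscretisation
import Literature.Probability.LatticeModels.TriangularLattice
import Literature.Probability.LatticeModels.LatticeInterface
import Literature.Probability.LatticeModels.MedialInterface
import HarnessLib
import HarnessLib.Audit

-- provenance: harness21/H21/H21/Statements/CritPerc/InterfaceScalingLimit.lean @ 8a3fbaf (interim HEAD d8f2665); M5 mechanical rewrite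
/-!
# Critical percolation: interface scaling limits and tightness (family `crit-perc`, S02/S04/S26)

Trunk `Stoch`, statement item St5 (`Outlines/Stoch.md`). Target statements about the scaling
limit of the percolation exploration interface in a Dobrushin domain `(Ω; a, b)`
(`Literature.DobrushinDomain = Literature.MarkedDomain 2`, prelude C6):

* **crit-perc.S02** (peak, OPEN CONJECTURE — Smirnov, ICM 2006, §2.3, Conj. 4 at `q = 1`;
  Schramm, ICM 2006, Problem 2.11; `def … : Prop` only, `[status: open]`): `SLE6LimitZ2`,
  convergence in law of the critical bond-percolation medial exploration interface on `δℤ²` to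
  chordal SLE₆ (canonical discretisations; the form with the discretisations quantified is
  `SLE6LimitZ2AllDiscretisations` in `InterfaceScalingLimitDiscretised.lean`, see the docstring).
* **crit-perc.S04** (Smirnov 2001, Thm. 2; Camia–Newman 2007, Thm. 5; Werner 2009, Thm. 3.1):
  `convergesInLawToSLE_six_triInterface`, the same statement for critical site percolation on
  the triangular lattice `δ𝕋`, for every admissible family of lattice approximations
  `(Ω_δ; a_δ, b_δ) → (Ω; a, b)` — a theorem in print, vendored as a named fact. (Restated
  2026-08-15 under its name: the earlier body hard-wired the canonical discretisation
  `dobrushinData D δ` behind an admissibility guard that fails at every mesh on the unit disc,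
  `CanonicalTriDiscretisationTies.lean`; that canonical-data statement is now the proved
  specialisation `convergesInLawToSLE_six_triInterface.triInterface`, under the extra hypothesis
  that the discrete marked points converge.)
* **crit-perc.S26** (Aizenman–Burchard 1999): tightness of the interface laws for `δ ∈ (0, 1]`
  in the space of curves modulo reparametrisation, `isTightLaws_map_bondInterface` and
  `isTightLaws_map_triInterface`, together with the a.e.-measurability statements
  `aemeasurable_bondInterface`/`aemeasurable_triInterface` which guarantee that the push-forward
  laws `Measure.map` appearing there are not the junk measure `0`. **Scope:** the inventory text
  of S26 also covers the *full loop collections*; only the single-interface half is stated here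
  (the loop-ensemble half needs the loop machinery of `Statements/CritPerc/CLE6` and
  `LoopRotationInvariance` and is recorded as omitted).

## The objects

All lattice objects come from the `StatMech` prelude (G02) and are *not* redefined here:
`Literature.Probability.LatticeModels.DiscreteDobrushin` (domain, mesh, two arcs), the hexagonal exploration curve
`Literature.Probability.LatticeModels.explorationCurve` of site percolation on `δ𝕋` (`LatticeInterface`), the medial
exploration curve `Literature.Probability.LatticeModels.medialExplorationCurve` of bond percolation on `δℤ²`
(`MedialInterface`), the measures `Literature.StatMech.bondPercolation (zdGraph 2) p` and
`Literature.StatMech.triSitePercolation p`, and the critical density `Literature.StatMech.half : unitInterval`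
(`p = 1/2`, critical for both models: Kesten 1980 for bond-`ℤ²`, and `p_c^{site}(𝕋) = 1/2`).
The SLE side comes from the `Stoch` prelude: `Literature.CurveClass ℂ` (curves modulo
reparametrisation, C9), `Literature.ConvergesInLawToSLE κ D X P` (C12; the limit object is a random
curve `Γ` characterised by `Literature.IsSLECurve κ D Γ`, never a bare `∃ μ`), `Literature.Probability.RandomPlanarGeometry.IsTightLaws` (C9,
Mathlib's `IsTightMeasureSet` on the image of `Set.Ioc 0 1`).

Local definitions (namespace `Literature.Probability.Percolation`):
* `dobrushinData D δ : DiscreteDobrushin := ⟨D.carrier, δ, D.arc 0, D.arc 1⟩` — the arc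
  `D.arc 0` from `a = D.pt 0` to `b = D.pt 1` carries the open / wired boundary condition, the
  complementary arc `D.arc 1` the closed / dual-wired one. (This is literally the same recipe as
  `Literature.Probability.LatticeModels.dobrushinData` in `Statements/CritIsing/InterfaceSLE`; statement files do not
  import each other, and hoisting it to a prelude as `DobrushinDomain.toDiscreteDobrushin` is
  left to the prelude owners — recorded in the SUBMIT notes.)
* `orientCurve D γ : Curve ℂ` — the endpoint rule re-orienting a discrete interface so that it
  runs from (near) `a` to (near) `b`, see "Orientation" below;
* `triInterface D δ ω : CurveClass ℂ`, the class of G02's (re-oriented) polygonal hexagonal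
  exploration curve;
* `bondInterface D δ ω : CurveClass ℂ`, the class of G02's (re-oriented) polygonal medial
  exploration curve.
In `ConvergesInLawToSLE` the family of configuration spaces is constant in `δ`
(`fun _ ↦ SiteConfig (Site 2)`, resp. `fun _ ↦ BondConfig (Site 2)`); only the interface map and
(trivially) the law depend on `δ`.

## Design choices (deviations from the outline's literal signatures)

* **Admissibility hypotheses (proper discretisations).** G02's exploration curves are the junk
  constant curve `0` unless the exploration path exists *uniquely*, which G02 guarantees only
  for admissible discrete Dobrushin data (`DiscreteDobrushin.IsAdmissible` on `δ𝕋`,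
  `existsUnique_explorationPath`; `DiscreteDobrushin.IsZdAdmissible` on `δℤ²`,
  `existsUnique_medialExploration`). On `δℤ²` admissibility genuinely fails for very symmetric
  domains: `discreteArc` uses `≤`, so a boundary site equidistant from the two closed arcs
  `D.arc 0`, `D.arc 1` lies on *both* discrete arcs, every edge at it is an `A`–`B` edge
  (`zdABEdges`), `ncard_zdABEdges_eq_two` fails and `medialExploration = []` — e.g. the unit
  disc with `a = 1`, `b = -1` and the sites `(k, 0)`. Without a guard `SLE6LimitZ2` would then be
  *refutable* (Dirac masses at a constant class do not converge to SLE₆) instead of open. Hence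
  every target statement below carries the hypothesis
  `∀ᶠ δ in 𝓝[>] 0, (dobrushinData D δ).IsZdAdmissible` (resp. `IsAdmissible` on `δ𝕋`), the
  library's rendering of "`(Ω_δ; a_δ, b_δ)` is a proper discretisation of `(Ω; a, b)` for all
  small `δ`", exactly as in `Statements/CritIsing/InterfaceSLE` (crit-ising.S16/S17). The
  cleaner fix is upstream (resolve ties in `zdArcB`/`zdABEdges` as `bcBondConfig` already does);
  the guard then becomes provable and can be dropped. **2026-08-15 (statement verdicts).** The
  guard is not merely unproved but *false* on the library's own `DobrushinDomain.unitDisc`, at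
  every mesh, for both lattices (tie sites of `zdDiscreteArc`/`triDiscreteArc`:
  `CanonicalDiscretisationTies.lean`, `CanonicalTriDiscretisationTies.lean`), so the guarded
  canonical-data statements are vacuous there, whereas the printed statements let the lattice
  approximation be *chosen* for each mesh (Camia–Newman 2007, §4.1 and Thm. 5; Werner 2009,
  §3.1, §3.6; Smirnov 2006, §2.1). Accordingly S04 (`convergesInLawToSLE_six_triInterface`) is
  now stated for every discretising family `E : ℝ → DiscreteDobrushin` (the `δ𝕋` twin of the
  reviewed rendering `LatticeModels.IsDiscretisation` of crit-ising.S17; same name, corrected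
  body — for its consumers the correction adds one hypothesis on the canonical family, see
  `convergesInLawToSLE_six_triInterface.triInterface`), while the open conjecture S02 keeps its
  name and canonical-data form (it is the crux of the `CardyFormulaZ2` routes) with a pointer to
  its quantified form `SLE6LimitZ2AllDiscretisations` (`InterfaceScalingLimitDiscretised.lean`).
  The tightness facts S26 keep the guard (not under verdict).
* **Orientation (`orientCurve`).** G02 orients both exploration paths by "open / arc-`A` sites on
  the left", while `MarkedDomain` deliberately does not fix the orientation of the boundary loop
  (`Prelude/Stoch/PlanarDomains`); so whether G02's curve runs `a_δ → b_δ` or `b_δ → a_δ` depends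
  on `D`. Chordal SLE_κ in `IsSLECurve κ D` runs from `a = D.pt 0` to `b = D.pt 1` and
  `CurveClass ℂ` remembers orientation, so each discrete interface is re-oriented by the endpoint
  rule: keep the curve if its starting point is at least as close to `a` as to `b`, time-reverse
  it (`unitInterval.symm`) otherwise. As the interface joins the discrete marked points
  `a_δ → a`, `b_δ → b`, this is the `a → b` orientation for all small `δ`. (By reversibility of
  SLE₆ the unoriented statements would be equivalent; we state the oriented ones.)
* **Boundary conditions on `δℤ²`.** G02's `bcBondConfig` wires the arc `(ab)` (edges of `Ω_δ`
  with both endpoints on `zdArcA` open) and *closes* every edge touching `zdArcB` (the arc `(ba)`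
  and the outside are dual-wired), rather than leaving `(ba)` free as in the printed convention;
  the two differ only at the sites of `(ba)` and have the same scaling limit (see the docstring
  of `DiscreteDobrushin.bcBondConfig`). S02 is stated for G02's rendering.

## Mathlib

Mathlib provides and we use: `MeasureTheory.IsTightMeasureSet` (via `Literature.Probability.RandomPlanarGeometry.IsTightLaws`),
`MeasureTheory.Measure.map`, `AEMeasurable`, `SeparationQuotient` (via `Literature.Probability.RandomPlanarGeometry.CurveClass`),
`unitInterval.symm`/`unitInterval.continuous_symm` (time reversal), `nhdsWithin`,
`Filter.Eventually`. Mathlib has no percolation interface, SLE, or curve-space tightness results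
(searched `percolation`, `SLE`, `Aizenman`, `exploration`, `Loewner`).

## References

* S. Smirnov, *Critical percolation in the plane*, C. R. Acad. Sci. Paris 333 (2001), Thm 2.
* F. Camia, C. M. Newman, *Critical percolation exploration path and SLE₆: a proof of
  convergence*, Probab. Theory Related Fields 139 (2007) 473–519 (arXiv:math/0604487), §3.1
  (the metric (2) on curves), §4.1 (exploration path; `δ`-approximations
  `(D^δ, a^δ, b^δ) → (D, a, b)`), Thm. 5 (§7, the convergence theorem).
* S. Smirnov, *Towards conformal invariance of 2D lattice models*, Proc. ICM 2006, Vol. II,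
  1421–1451 (arXiv:0708.0032), §2.1, §2.3 Conjecture 4 (FK interfaces → SLE(κ),
  `κ = 4π / arccos(−√q/2)`; `q = 1` is critical bond percolation on `ℤ²`, ibid.).
* O. Schramm, *Conformally invariant scaling limits: an overview and a collection of problems*,
  Proc. ICM 2006, Vol. I (arXiv:math/0602151), Problem 2.11.
* M. Aizenman, A. Burchard, *Hölder regularity and dimension bounds for random curves*, Duke
  Math. J. 99 (1999), Thms 1.1–1.2.
* O. Schramm, *Scaling limits of loop-erased random walks and uniform spanning trees*, Israel J.
  Math. 118 (2000) (identification `κ = 6`).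
* W. Werner, *Lectures on two-dimensional critical percolation*, IAS/Park City Math. Ser. 16
  (2009) 297–360 (arXiv:0710.0856), Lecture 3: Thm. 3.1 (triangular lattice), §3.6 (conditions
  on the lattice approximations), and p. 4 ("for other planar lattices, these conjectures are at
  present (i.e. in 2007) not proved").
* `summits/crit-perc-z2/SUMMIT.md`, statement `S_SLE`.
-/

noncomputable section

open MeasureTheory Filter Topology
open scoped unitInterval

namespace Literature.Probability.Percolation

section CritPerc

open LatticeModels

/-! ### Discrete Dobrushin data -/

/-- The discrete Dobrushin data of the Dobrushin domain `(D; a, b)` at mesh `δ`: the domain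
`D.carrier`, the mesh `δ`, the arc `A = D.arc 0` (from `a = D.pt 0` to `b = D.pt 1`, carrying
the open / wired boundary condition) and the arc `B = D.arc 1` (from `b` to `a`, closed /
dual-wired). Same recipe as `Literature.Probability.LatticeModels.dobrushinData`. (Smirnov 2001, §2; Camia–Newman
2007, §2.) [cite: Smirnov2001, §2] -/
def dobrushinData (D : RandomPlanarGeometry.DobrushinDomain) (δ : ℝ) : DiscreteDobrushin :=
  ⟨D.carrier, δ, D.arc 0, D.arc 1⟩

/-- The domain of `dobrushinData D δ` is `D.carrier`. (Smirnov 2001, §2.) [cite: Smirnov2001, §2] -/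
@[simp] theorem dobrushinData_Ω (D : RandomPlanarGeometry.DobrushinDomain) (δ : ℝ) :
    (dobrushinData D δ).Ω = D.carrier := rfl

/-- The mesh of `dobrushinData D δ` is `δ`. (Smirnov 2001, §2.) [cite: Smirnov2001, §2] -/
@[simp] theorem dobrushinData_δ (D : RandomPlanarGeometry.DobrushinDomain) (δ : ℝ) : (dobrushinData D δ).δ = δ := rfl

/-- The open / wired arc of `dobrushinData D δ` is `D.arc 0` (from `a` to `b`).
(Smirnov 2001, §2.) [cite: Smirnov2001, §2] -/
@[simp] theorem dobrushinData_arcA (D : RandomPlanarGeometry.DobrushinDomain) (δ : ℝ) :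
    (dobrushinData D δ).arcA = D.arc 0 := rfl

/-- The closed / dual-wired arc of `dobrushinData D δ` is `D.arc 1` (from `b` to `a`).
(Smirnov 2001, §2.) [cite: Smirnov2001, §2] -/
@[simp] theorem dobrushinData_arcB (D : RandomPlanarGeometry.DobrushinDomain) (δ : ℝ) :
    (dobrushinData D δ).arcB = D.arc 1 := rfl

/-! ### Orientation of discrete interfaces -/

/-- Time reversal of a parametrised curve `[0, 1] → E`: `t ↦ γ (1 - t)` (Mathlib's
`unitInterval.symm`; the analogue of `Path.symm` for unbased curves). (Aizenman–Burchard 1999,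
§2.1.) [cite: AizenmanBurchard1999, §2.1] -/
def reverseCurve {E : Type*} [TopologicalSpace E] (γ : C(I, E)) : C(I, E) :=
  γ.comp ⟨σ, unitInterval.continuous_symm⟩

/-- `reverseCurve γ t = γ (1 - t)`. (Aizenman–Burchard 1999, §2.1.) [cite: AizenmanBurchard1999, §2.1] -/
@[simp] theorem reverseCurve_apply {E : Type*} [TopologicalSpace E] (γ : C(I, E)) (t : I) :
    reverseCurve γ t = γ (σ t) := rfl

/-- Time reversal is an involution. (Aizenman–Burchard 1999, §2.1.) [cite: AizenmanBurchard1999, §2.1] -/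
@[simp] theorem reverseCurve_reverseCurve {E : Type*} [TopologicalSpace E] (γ : C(I, E)) :
    reverseCurve (reverseCurve γ) = γ := by
  ext t
  simp

/-- **Endpoint rule.** Re-orient a parametrised planar curve so that it runs from (near)
`a = D.pt 0` to (near) `b = D.pt 1`: keep `γ` if its starting point `γ 0` is at least as close
to `a` as to `b`, time-reverse it otherwise. Needed because G02 orients exploration paths by
"arc `A` on the left" while `MarkedDomain` does not fix the orientation of the boundary loop,
whereas chordal SLE_κ (`IsSLECurve`) runs from `a` to `b` and `CurveClass ℂ` remembers
orientation. (Camia–Newman 2007, §2: the exploration path from `a_δ` to `b_δ`; cf.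
`Literature.Probability.LatticeModels.orientChord`.) [cite: CamiaNewman2007, §2: the exploration path from  a_δ  to] -/
def orientCurve (D : RandomPlanarGeometry.DobrushinDomain) (γ : C(I, ℂ)) : RandomPlanarGeometry.Curve ℂ :=
  if dist (γ 0) (D.pt 0) ≤ dist (γ 0) (D.pt 1) then ⟨γ⟩ else ⟨reverseCurve γ⟩

/-- A curve starting at least as close to `a` as to `b` is already oriented.
(Camia–Newman 2007, §2.) [cite: CamiaNewman2007, §2] -/
theorem orientCurve_of_le (D : RandomPlanarGeometry.DobrushinDomain) {γ : C(I, ℂ)}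
    (h : dist (γ 0) (D.pt 0) ≤ dist (γ 0) (D.pt 1)) : orientCurve D γ = ⟨γ⟩ := by
  simp [orientCurve, h]

/-- A curve starting closer to `b` than to `a` is time-reversed. (Camia–Newman 2007, §2.) [cite: CamiaNewman2007, §2] -/
theorem orientCurve_of_lt (D : RandomPlanarGeometry.DobrushinDomain) {γ : C(I, ℂ)}
    (h : dist (γ 0) (D.pt 1) < dist (γ 0) (D.pt 0)) : orientCurve D γ = ⟨reverseCurve γ⟩ := by
  simp [orientCurve, not_le.2 h]

/-- `orientCurve D γ` is `γ` or its time reversal. (Camia–Newman 2007, §2.) [cite: CamiaNewman2007, §2] -/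
theorem orientCurve_eq_or (D : RandomPlanarGeometry.DobrushinDomain) (γ : C(I, ℂ)) :
    orientCurve D γ = ⟨γ⟩ ∨ orientCurve D γ = ⟨reverseCurve γ⟩ := by
  by_cases h : dist (γ 0) (D.pt 0) ≤ dist (γ 0) (D.pt 1) <;> simp [orientCurve, h]

/-- Re-orientation does not change the trace of the curve. (Aizenman–Burchard 1999, §2.1.) [cite: AizenmanBurchard1999, §2.1] -/
theorem range_orientCurve (D : RandomPlanarGeometry.DobrushinDomain) (γ : C(I, ℂ)) :
    (orientCurve D γ).range = Set.range γ := by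
  rcases orientCurve_eq_or D γ with h | h <;> rw [h]
  · rfl
  · change Set.range (fun t ↦ γ (σ t)) = Set.range γ
    exact unitInterval.symm_bijective.surjective.range_comp γ

/-! ### The interfaces as curve classes -/

/-- The **site-percolation interface** on `δ𝕋` in the Dobrushin domain `D`: the class, in the
space `CurveClass ℂ` of planar curves modulo reparametrisation, of G02's polygonal hexagonal
exploration curve `explorationCurve (dobrushinData D δ) ω` (open / arc-`A` hexagons on its left,
closed / arc-`B` hexagons on its right; junk constant curve `0` if the exploration path is not
uniquely defined), re-oriented to run from `a_δ` to `b_δ` (`orientCurve`).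
(Smirnov 2001, §2; Camia–Newman 2007, §2.) [cite: Smirnov2001, §2] -/
def triInterface (D : RandomPlanarGeometry.DobrushinDomain) (δ : ℝ) (ω : SiteConfig (Site 2)) : RandomPlanarGeometry.CurveClass ℂ :=
  RandomPlanarGeometry.CurveClass.mk (orientCurve D (explorationCurve (dobrushinData D δ) ω))

/-- The **bond-percolation interface** on `δℤ²` in the Dobrushin domain `D`: the class in
`CurveClass ℂ` of G02's polygonal medial exploration curve
`medialExplorationCurve (dobrushinData D δ) ω`, separating the open cluster of the (wired) arc
`A` on its left from the dual-open cluster of the (dual-wired) arc `B` on its right (junk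
constant curve `0` if the medial exploration path is not uniquely defined, in particular
whenever `dobrushinData D δ` is not `IsZdAdmissible`), re-oriented to run from `a_δ` to `b_δ`
(`orientCurve`). (Smirnov 2001, §2, square-lattice version; Grimmett 1999, §11.2;
summits/crit-perc-z2/SUMMIT.md `S_SLE`.) [cite: Smirnov2001, §2  square-lattice version] -/
def bondInterface (D : RandomPlanarGeometry.DobrushinDomain) (δ : ℝ) (ω : BondConfig (Site 2)) : RandomPlanarGeometry.CurveClass ℂ :=
  RandomPlanarGeometry.CurveClass.mk (orientCurve D (medialExplorationCurve (dobrushinData D δ) ω))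

/-- Unfolding `triInterface`. (Camia–Newman 2007, §2.) [cite: CamiaNewman2007, §2] -/
theorem triInterface_apply (D : RandomPlanarGeometry.DobrushinDomain) (δ : ℝ) (ω : SiteConfig (Site 2)) :
    triInterface D δ ω = RandomPlanarGeometry.CurveClass.mk (orientCurve D (explorationCurve (dobrushinData D δ) ω)) :=
  rfl

/-- Unfolding `bondInterface`. (Smirnov 2001, §2.) [cite: Smirnov2001, §2] -/
theorem bondInterface_apply (D : RandomPlanarGeometry.DobrushinDomain) (δ : ℝ) (ω : BondConfig (Site 2)) :
    bondInterface D δ ω =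
      RandomPlanarGeometry.CurveClass.mk (orientCurve D (medialExplorationCurve (dobrushinData D δ) ω)) :=
  rfl

/-- The trace of the triangular interface is the trace of G02's exploration curve
(re-orientation and passage to `CurveClass` do not change it). (Camia–Newman 2007, §2.) [cite: CamiaNewman2007, §2] -/
theorem range_triInterface (D : RandomPlanarGeometry.DobrushinDomain) (δ : ℝ) (ω : SiteConfig (Site 2)) :
    (triInterface D δ ω).range = Set.range (explorationCurve (dobrushinData D δ) ω) := by
  rw [triInterface, RandomPlanarGeometry.CurveClass.range_mk, range_orientCurve]

/-- The trace of the bond interface is the trace of G02's medial exploration curve.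
(Smirnov 2001, §2.) [cite: Smirnov2001, §2] -/
theorem range_bondInterface (D : RandomPlanarGeometry.DobrushinDomain) (δ : ℝ) (ω : BondConfig (Site 2)) :
    (bondInterface D δ ω).range = Set.range (medialExplorationCurve (dobrushinData D δ) ω) := by
  rw [bondInterface, RandomPlanarGeometry.CurveClass.range_mk, range_orientCurve]

/-! ### Measurability of the interfaces -/

/-- The bond-percolation interface `bondInterface D δ` on `δℤ²` is a.e.-measurable under
critical bond percolation `P_{1/2}` (with respect to the Borel σ-algebra of `CurveClass ℂ`), so
that its law `(bondPercolation (zdGraph 2) half).map (bondInterface D δ)` is a genuine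
push-forward and not Mathlib's junk value `0`. For a bounded domain and `δ > 0` the medial
exploration path ranges over finitely many lattice paths, each determined by a cylinder event
(the states of finitely many edges), hence the map is in fact measurable with finite range; for
an unbounded domain or `δ ≤ 0` it is constant. No admissibility hypothesis is needed.
(Aizenman–Burchard, Duke Math. J. 99 (1999), §2.1: interface laws as Borel measures on curve
space; Smirnov 2001, §2.) [cite: Smirnov2001, §2] -/
def aemeasurable_bondInterface : Prop :=
  ∀ (D : RandomPlanarGeometry.DobrushinDomain) (δ : ℝ),
    AEMeasurable (bondInterface D δ) (bondPercolation (zdGraph 2) half)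

/-- The site-percolation interface `triInterface D δ` on `δ𝕋` is a.e.-measurable under critical
site percolation `P_{1/2}`, so that its law `(triSitePercolation half).map (triInterface D δ)` is
a genuine push-forward (same finite-range / cylinder-event argument as for
`aemeasurable_bondInterface`). (Aizenman–Burchard 1999, §2.1; Camia–Newman, Probab. Theory
Related Fields 139 (2007), §2.) [cite: AizenmanBurchard1999, §2.1] -/
def aemeasurable_triInterface : Prop :=
  ∀ (D : RandomPlanarGeometry.DobrushinDomain) (δ : ℝ),
    AEMeasurable (triInterface D δ) (triSitePercolation half)

/-! ### crit-perc.S02: the SLE₆ scaling limit on `ℤ²` (OPEN CONJECTURE) -/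

/-- OPEN CONJECTURE — **crit-perc.S02**, conformal invariance of critical bond percolation on
`ℤ²`, interface form. Posed in: S. Smirnov, *Towards conformal invariance of 2D lattice models*,
Proc. ICM 2006, Vol. II, §2.3, **Conjecture 4** at `q = 1` ("For all `q ∈ [0, 4]`, as the lattice
step goes to zero, the law of the interface converges to Schramm-Loewner Evolution with
`κ = 4π / arccos(−√q/2)`" — the interface of the self-dual, `p = p_sd = √q/(√q+1) = 1/2`,
random-cluster model with Dobrushin boundary conditions, wired on `(ab)` and dual-wired on
`(ba)`; for `q = 1` this is critical bond percolation on the square lattice and `κ = 6`, and the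
same §2.3 lists `q = 1` among the values where the method "does not yet work all the way");
equally
O. Schramm, ICM 2006, Problem 2.11 ("Prove Smirnov's theorem for critical bond percolation on
`ℤ²`"), and W. Werner, *Lectures on two-dimensional critical percolation* (2009), p. 4 ("for
other planar lattices, these conjectures are at present (i.e. in 2007) not proved"; Thm. 3.1
there is the triangular-site theorem, here `convergesInLawToSLE_six_triInterface`).
[status: open] — no discharge `SLE6LimitZ2_holds` exists short of solving the problem (known on
`ℤ²`: RSW, Aizenman–Burchard tightness `isTightLaws_map_bondInterface`, and rotation invariance
of subsequential limits, Duminil-Copin–Kozlowski–Krachun–Manolescu–Oulamara 2020). The name is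
kept because it is the crux `X_C1` of the `CardyFormulaZ2` routes
(`Summits/CriticalPhenomena/CardyFormulaZ2/Theses/CardyViaSLE6.lean`, `…/CardyRotToConf.lean`).

**Statement** (summits/crit-perc-z2/SUMMIT.md `S_SLE`; identification `κ = 6`: Schramm, Israel
J. Math. 118 (2000)). For every Dobrushin domain `(Ω; a, b)` whose canonical square-lattice
discretisations `(Ω_δ; a_δ, b_δ) = dobrushinData D δ` are admissible Dobrushin data
(`IsZdAdmissible`: proper discretisations, see the module docstring) for all small `δ > 0`, with
the edges of `Ω_δ` along the arc `(ab)` declared open and the edges at the arc `(ba)` closed,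
i.e. their dual edges dual-open (G02's `bcBondConfig`, which freezes `(ba)` closed rather than
free — same scaling limit, see `DiscreteDobrushin.bcBondConfig`), the medial exploration
interface `γ_δ` of critical bond percolation `P_{1/2}` on `δℤ²` from `a_δ` to `b_δ`
(`bondInterface D δ`) converges in law as `δ → 0⁺`, in the space `CurveClass ℂ` of curves
modulo reparametrisation, to chordal SLE₆ in `(Ω; a, b)`: there is a random curve `Γ` with
`IsSLECurve 6 D Γ` such that `bondInterface D δ → Γ` in law (`ConvergesInLawToSLE`).

**Rendering caveat** (statement finding of the 2026-08-15 verdict, recorded in full in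
`InterfaceScalingLimitDiscretised.lean`). This def hard-wires ONE discretisation scheme, the
canonical data `dobrushinData D δ = ⟨Ω, δ, (ab), (ba)⟩`, behind the admissibility guard, whereas
Smirnov (§2.1: "we approximate a given domain `Ω` by a lattice domain") lets the lattice
approximation be chosen for each mesh. The guard fails at **every** mesh for
`DobrushinDomain.unitDisc` (tie sites of `zdDiscreteArc`: `not_isZdAdmissible_dobrushinData_unitDisc`,
whence `sle6LimitZ2_unitDisc_vacuous`, `CanonicalDiscretisationTies.lean`) and, by a hand
computation recorded there, along meshes `δ_k → 0⁺` for every axis-aligned rectangle, so this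
form is silent about the domains the conjecture is usually stated for. The conjecture with the
discretisations quantified (the reviewed rendering of crit-ising.S17) is
`SLE6LimitZ2AllDiscretisations` (`InterfaceScalingLimitDiscretised.lean`, which imports this
file, whence no `@[deprecated]` link from here); it implies the present form on every domain
whose canonical data are eventually admissible and have convergent discrete marked points
(`sle6LimitZ2_of_allDiscretisations`). [cite: Smirnov2007ICM, §2.3 Conjecture 4 at q = 1] -/
@[conjecture] def SLE6LimitZ2 : Prop :=
  ∀ D : RandomPlanarGeometry.DobrushinDomain, (∀ᶠ δ in 𝓝[>] (0 : ℝ), (dobrushinData D δ).IsZdAdmissible) →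
    RandomPlanarGeometry.ConvergesInLawToSLE 6 D (Ωδ := fun _ ↦ BondConfig (Site 2)) (bondInterface D)
      fun _ ↦ bondPercolation (zdGraph 2) half

/-! ### crit-perc.S04: Smirnov / Camia–Newman convergence of the triangular exploration path -/

/-- **crit-perc.S04** (F. Camia, C. M. Newman, *Critical percolation exploration path and SLE₆:
a proof of convergence*, Probab. Theory Related Fields 139 (2007) 473–519, **Theorem 5** (§7);
announced with a sketch of proof in S. Smirnov, C. R. Acad. Sci. Paris 333 (2001), Thm. 2;
W. Werner, *Lectures on two-dimensional critical percolation* (2009), Thm. 3.1). **The critical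
site-percolation exploration path on the triangular lattice converges to chordal SLE₆, for every
admissible choice of the lattice approximations.** Printed statement (Camia–Newman, Thm. 5):
"Let `(D, a, b)` be a Jordan domain with two distinct selected points on its boundary `∂D`.
Then, for Jordan sets `D^δ` from `δ𝓗` with two distinct selected e-vertices `a^δ, b^δ` on their
boundaries `∂D^δ`, such that `(D^δ, a^δ, b^δ) → (D, a, b)` as `δ → 0`, the percolation
exploration path `γ^δ_{D,a,b}` inside `D^δ` from `a^δ` to `b^δ` converges in distribution to the
trace `γ_{D,a,b}` of chordal SLE₆ inside `D` from `a` to `b`, as `δ → 0`." Here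
`(D^δ, a^δ, b^δ) → (D, a, b)` means `∂D^δ → ∂D`, `a^δ → a` and `b^δ → b` (§4.1),
convergence in distribution refers to the sup–inf metric (2) of §3.1 on curves
modulo monotone reparametrisation (the tree's `CurveClass ℂ`), and `ℙ` is critical site
percolation (`p = 1/2`) on `𝕋` (§4); Werner's Thm. 3.1 is the same statement for "a lattice
approximation `D_δ, x_δ, c_δ` of the triplet `D, x, c`" that "we choose" (§3.1), the admissible
choices being spelled out in §3.6.

In the tree's vocabulary, following the reviewed rendering of the sister statement
crit-ising.S17 (`LatticeModels.convergesInLawToSLE_sixteen_thirds_fkInterface`, hypothesis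
structure `LatticeModels.IsDiscretisation`): for every Dobrushin (Jordan) domain
`(Ω; a, b) = D` and every family `E : ℝ → DiscreteDobrushin` of G02 discrete Dobrushin data on
`δ𝕋` which *discretises* `D` — (i) domain `(E δ).Ω = Ω`, so that the discrete domain is the
canonical vertex set `triMeshDomain Ω δ`, and (ii) mesh `(E δ).δ = δ`; (iii), (iv) the two arcs
of the data (which are free, so that the tie sites of `triDiscreteArc` can be avoided) converge
to `(ab) = D.arc 0` and `(ba) = D.arc 1` in the Hausdorff extended distance; (v) the discrete
marked points `a_δ`, `b_δ` — the rescaled centres `δ · hexCenter f` of the outer `A`–`B` faces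
`f ∈ (E δ).abFaces`, Camia–Newman's selected e-vertices up to half a lattice spacing — converge
to `{a, b}`; and (vi) `E δ` is admissible (`DiscreteDobrushin.IsAdmissible`, the hypothesis of
G02's `existsUnique_explorationPath`) for all small `δ > 0` —, the hexagonal exploration path of
critical site percolation `P_{1/2}` in `E δ` (open / arc-`A` hexagons on its left, closed /
arc-`B` hexagons on its right: G02's `explorationCurve (E δ)`), re-oriented to run from `a_δ` to
`b_δ` by the endpoint rule `orientCurve D` and taken modulo reparametrisation, converges in law
as `δ → 0⁺` to chordal SLE₆ in `(Ω; a, b)` (`ConvergesInLawToSLE 6 D`: to a random curve `Γ`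
with `IsSLECurve 6 D Γ`). The hypotheses (i)–(vi) are, in this order, the fields of the
structure `IsTriDiscretisation D E`, and the interface map is `triInterfaceIn D (E δ)`, both of
`TriInterfaceSLE.lean` — which imports the present file, whence the unbundled form here, and
which proves the reduction of this convergence, family by family, to tightness and the
identification of subsequential limits (`convergesInLawToSLE_triInterfaceIn_of_subseqLimits'`,
`convergesInLawToSLE_triInterfaceIn_of_layer2'`). *Scope and rendering conventions:* this
renders Theorem 5 for the `δ`-approximations expressible by G02's `DiscreteDobrushin` (hexagon
set the largest component `triMeshDomain Ω δ` of `Ω ∩ δ𝕋`, boundary colours imposed through the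
distance recipe `triDiscreteArc` from a chosen pair of closed arcs), with two conventions that
differ from the letter of the source exactly as in the reviewed crit-ising.S17: Camia–Newman's
`∂D^δ → ∂D` (distance (2) between the three boundary arcs as curves, §4) is rendered by
Hausdorff convergence of the arcs of the data, and their standing assumption that `D^δ` is a
*Jordan set* (a simply connected set of hexagons whose s-boundary is a `𝒯`-loop, §4) with
e-vertices `a^δ, b^δ` is rendered by G02's admissibility of the data (`IsAdmissible`: the
combinatorial conditions under which the exploration path from `a_δ` to `b_δ` is unique). No
`IsTriDiscretisation` family has yet been constructed in the tree for a given domain (expected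
witness for the disc: the two half circles rotated by an angle `≍ δ`), so non-vacuity at a
given `D` is an expectation, not a theorem; the statement is junk-free only under G02's named
fact `existsUnique_explorationPath` (otherwise `explorationCurve` is the constant curve `0`). **Restated 2026-08-15 under the same name** (statement verdict
"misstated" of the proving seat holding tenure on this fact): the earlier body hard-wired ONE
discretisation scheme, the canonical data `dobrushinData D δ = ⟨Ω, δ, (ab), (ba)⟩`, behind the
guard `∀ᶠ δ in 𝓝[>] 0, (dobrushinData D δ).IsAdmissible`; since `triDiscreteArc` compares
distances to `(ab)`, `(ba)` with `≤`, a boundary site equidistant from the two arcs lies on both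
discrete arcs and `IsAdmissible.disjoint` fails — for `DobrushinDomain.unitDisc` at **every**
mesh (`not_isAdmissible_dobrushinData_unitDisc`, `CanonicalTriDiscretisationTies.lean`), so that
body held vacuously at the disc (`convergesInLawToSLE_six_triInterface_unitDisc_vacuous` there),
and where the guard does hold the printed hypothesis `a^δ → a`, `b^δ → b` is not known to follow
from it; that canonical-data statement is now the proved specialisation
`convergesInLawToSLE_six_triInterface.triInterface` (one more hypothesis: convergent discrete
marked points), and the reductions of `TriInterfaceSLE.lean` conclude it in spelled-out form.
Named fact (not proved here). [cite: CamiaNewman2007, Thm. 5] -/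
def convergesInLawToSLE_six_triInterface : Prop :=
  ∀ (D : RandomPlanarGeometry.DobrushinDomain) (E : ℝ → DiscreteDobrushin),
    (∀ δ, (E δ).Ω = D.carrier) → (∀ δ, (E δ).δ = δ) →
    Tendsto (fun δ ↦ Metric.hausdorffEDist (E δ).arcA (D.arc 0)) (𝓝[>] 0) (𝓝 0) →
    Tendsto (fun δ ↦ Metric.hausdorffEDist (E δ).arcB (D.arc 1)) (𝓝[>] 0) (𝓝 0) →
    Tendsto (fun δ ↦ Metric.hausdorffEDist
        ((fun f : HexVertex ↦ ((E δ).δ : ℂ) * hexCenter f) '' (E δ).abFaces) {D.pt 0, D.pt 1})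
      (𝓝[>] 0) (𝓝 0) →
    (∀ᶠ δ in 𝓝[>] (0 : ℝ), (E δ).IsAdmissible) →
    RandomPlanarGeometry.ConvergesInLawToSLE 6 D (Ωδ := fun _ ↦ SiteConfig (Site 2))
      (fun δ ω ↦ RandomPlanarGeometry.CurveClass.mk (orientCurve D (explorationCurve (E δ) ω)))
      fun _ ↦ triSitePercolation half

/-- **The printed statement specialised to the canonical discretisation** (this was, guarded by
`hadm` alone, the body of `convergesInLawToSLE_six_triInterface` until its 2026-08-15
restatement). If `convergesInLawToSLE_six_triInterface` holds, then for every Dobrushin domain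
`D` whose canonical data `dobrushinData D δ` are admissible for all small `δ > 0` *and* whose
discrete marked points (centres of the two outer `A`–`B` faces) converge to `{a, b}`, the
canonical interface `triInterface D δ` of critical site percolation converges in law to chordal
SLE₆ in `D`: the canonical family `dobrushinData D` then satisfies the six hypotheses (domain and
mesh by `rfl`, the arcs of the data *are* `(ab)`, `(ba)` — `hausdorffEDist_self` —, and the last
two are assumed), and `triInterface D δ` is the interface of `dobrushinData D δ` by definition.
(The second hypothesis on `D` is the geometric input (GAP) of `Sweep1Proofs.lean` transposed to
`δ𝕋`; it is not known to follow from the first.) Same computation as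
`convergesInLawToSLE_triInterface_of_allDiscretisations` (`TriInterfaceSLE.lean`). PROVED.
[cite: CamiaNewman2007, Thm. 5] -/
theorem convergesInLawToSLE_six_triInterface.triInterface
    (h : convergesInLawToSLE_six_triInterface)
    (D : RandomPlanarGeometry.DobrushinDomain)
    (hadm : ∀ᶠ δ in 𝓝[>] (0 : ℝ), (dobrushinData D δ).IsAdmissible)
    (hab : Tendsto (fun δ : ℝ ↦ Metric.hausdorffEDist
      ((fun f : HexVertex ↦ ((dobrushinData D δ).δ : ℂ) * hexCenter f) '' (dobrushinData D δ).abFaces)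
        {D.pt 0, D.pt 1}) (𝓝[>] 0) (𝓝 0)) :
    RandomPlanarGeometry.ConvergesInLawToSLE 6 D (Ωδ := fun _ ↦ SiteConfig (Site 2))
      (triInterface D) fun _ ↦ triSitePercolation half :=
  h D (dobrushinData D) (fun _ ↦ rfl) (fun _ ↦ rfl)
    (by simpa only [dobrushinData_arcA, Metric.hausdorffEDist_self] using tendsto_const_nhds)
    (by simpa only [dobrushinData_arcB, Metric.hausdorffEDist_self] using tendsto_const_nhds)
    hab hadm

/-! ### crit-perc.S26: Aizenman–Burchard tightness -/

/-- **crit-perc.S26** (Aizenman–Burchard, *Hölder regularity and dimension bounds for random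
curves*, Duke Math. J. 99 (1999), Thms 1.1–1.2, bond-`ℤ²` case; single-interface half — the
loop-collection half of the inventory statement is not stated in this file). **Tightness of
critical percolation interfaces on `δℤ²`**: for every Dobrushin domain `(Ω; a, b)` with
admissible discretisations for all small `δ > 0` (`IsZdAdmissible`, so that `bondInterface D δ`
is the genuine interface and not the junk constant class near `δ = 0`), the laws
`(P_{1/2}).map (bondInterface D δ)`, `δ ∈ (0, 1]`, of the medial exploration interface of
critical bond percolation on `δℤ²` form a tight family of measures on the space `CurveClass ℂ`
of curves modulo reparametrisation (`IsTightLaws`, i.e. Mathlib's `IsTightMeasureSet` of the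
image of `Set.Ioc 0 1`); in particular subsequential scaling limits exist (Prokhorov). The
hypothesis of AB99 Thm 1.2 (uniform power bounds on multiple crossings of annuli) holds for
critical percolation by the Russo–Seymour–Welsh estimates and the BK inequality (AB99, §1 and
Appendix). The push-forwards are genuine by `aemeasurable_bondInterface`. [cite: AizenmanBurchard1999, Thms 1.1–1.2] -/
def isTightLaws_map_bondInterface : Prop :=
  ∀ (D : RandomPlanarGeometry.DobrushinDomain) (hD : ∀ᶠ δ in 𝓝[>] (0 : ℝ), (dobrushinData D δ).IsZdAdmissible),
    RandomPlanarGeometry.IsTightLaws fun δ ↦ (bondPercolation (zdGraph 2) half).map (bondInterface D δ)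

/-- **crit-perc.S26** (Aizenman–Burchard, Duke Math. J. 99 (1999), Thms 1.1–1.2, triangular
case; used in Camia–Newman, PTRF 139 (2007), §2 and Smirnov 2001; single-interface half — the
loop-collection half is not stated in this file). **Tightness of critical percolation
interfaces on `δ𝕋`**: for every Dobrushin domain `(Ω; a, b)` with admissible discretisations
for all small `δ > 0` (`IsAdmissible`), the laws `(P_{1/2}).map (triInterface D δ)`,
`δ ∈ (0, 1]`, of the hexagonal exploration path of critical site percolation on `δ𝕋` form a
tight family of measures on `CurveClass ℂ` (`IsTightLaws`). The push-forwards are genuine by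
`aemeasurable_triInterface`. [cite: Smirnov2001] -/
def isTightLaws_map_triInterface : Prop :=
  ∀ (D : RandomPlanarGeometry.DobrushinDomain) (hD : ∀ᶠ δ in 𝓝[>] (0 : ℝ), (dobrushinData D δ).IsAdmissible),
    RandomPlanarGeometry.IsTightLaws fun δ ↦ (triSitePercolation half).map (triInterface D δ)

/-- Consequence of S04 recorded for convenience: on a Dobrushin domain whose canonical data are
eventually admissible and have convergent discrete marked points, the triangular interface laws
converge in law (`TendstoLaw`, bounded continuous test functions along `𝓝[>] 0`) to a random
curve whose law is *the* chordal SLE₆ law in `D` (`IsSLELaw`, unique by `existsUnique_isSLELaw`).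
Immediate from the fact `convergesInLawToSLE_six_triInterface` (the hypothesis `hS04`), its
canonical specialisation `.triInterface` and
`ConvergesInLawToSLE.exists_tendstoLaw`. (Camia–Newman 2007, Thm. 5.) [cite: CamiaNewman2007, Thm. 5] -/
theorem exists_isSLELaw_tendstoLaw_triInterface
    (hS04 : convergesInLawToSLE_six_triInterface)
    (D : RandomPlanarGeometry.DobrushinDomain) (hD : ∀ᶠ δ in 𝓝[>] (0 : ℝ), (dobrushinData D δ).IsAdmissible)
    (hab : Tendsto (fun δ : ℝ ↦ Metric.hausdorffEDist
      ((fun f : HexVertex ↦ ((dobrushinData D δ).δ : ℂ) * hexCenter f) '' (dobrushinData D δ).abFaces)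
        {D.pt 0, D.pt 1}) (𝓝[>] 0) (𝓝 0)) :
    ∃ Γ, RandomPlanarGeometry.IsSLELaw 6 D (Process.preWienerMeasure.map Γ) ∧
      RandomPlanarGeometry.TendstoLaw (Ωδ := fun _ ↦ SiteConfig (Site 2)) (triInterface D)
        (fun _ ↦ triSitePercolation half) Γ Process.preWienerMeasure :=
  (hS04.triInterface D hD hab).exists_tendstoLaw

end CritPerc

end Literature.Probability.Percolation
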